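import Literature.NumberTheory.Automorphic.ShimuraCurveJacquetLanglandsReductionProofs
import Literature.NumberTheory.EllipticCurves.EichlerShimuraConstructionLatticeProofs
import HarnessLib

/-!
# Shimura-curve parametrisations along `ℚ`-isogenies, and the reduction of
# `nonempty_shimuraParametrizationData` to Modularity + Jacquet–Langlands transfer + Shimura's
# construction `A_{[χ]}` (Faltings' theorem discharged by the tree)

A proofs-only companion (theorems only: no definition, no named fact, nothing restated; D-0026) of
`ShimuraCurveRibetTakahashi.lean`, written by the seat of its named fact
`Literature.NumberTheory.Automorphic.nonempty_shimuraParametrizationData` (Pasten 2024, §2 p. 12: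
"for each admissible factorization `N = DM`, the Jacquet–Langlands correspondence gives an optimal
quotient `q_{D,M} : J₀^D(M) → A_{D,M}` defined over `ℚ`, with `A_{D,M}` isogenous to `E`").

The printed sentence has three inputs at `D > 1`: the modularity of `E` (its newform `f` of level
`N`), the Jacquet–Langlands transfer of `f` to the Hecke module `S₂^D(M)` (Pasten §4.10), and
Shimura's construction `[χ] ↦ q_{[χ]} : J₀^D(M) → A_{[χ]}` (§4.11) — an abelian variety over `ℚ`
of dimension `#[χ]` attached to the CLASS OF THE EIGENFORM, with `a_ℓ(A_{[χ]}) = χ(T_ℓ)`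
(Eichler–Shimura); that `A_{D,M} = A_{[χ_f]}` is isogenous to `E` is then Faltings' isogeny
theorem. The tree's earlier reduction
(`nonempty_shimuraParametrizationData_of_exists_isNewformOf_of_transfer_of_construction`,
`ShimuraCurveJacquetLanglandsReductionProofs`) bundled Shimura's construction AND Faltings into one
hypothesis (S) ("a form in the Hecke line of `W` has a multiple with periods in `Λ_W`"). Since
Faltings' theorem (`WeierstrassCurve.isIsogenous_iff_frobeniusTrace_eq_holds`) and the
commensurability of the Néron lattices of `ℚ`-isogenous curves
(`neronLattice_commensurable_of_isIsogenous_holds`) are THEOREMS of the tree, this file splits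
them off: the residual hypothesis (S₁) is Shimura's construction alone, whose conclusion names the
curve `A = A_g` it constructs and not `W`:

  (S₁) for `N = D M` admissible, `1 < D`, `X`, and a non-zero `g ∈ S₂(X.Gamma)` whose
  `T_ℓ`-eigenvalues (`ℓ ∤ N` prime) are those of an elliptic curve of conductor `N` (this is how
  "the system `[χ_g]` is new of level `M`, with `#[χ_g] = 1`" is said over the tree), there are an
  elliptic curve `A/ℚ`, a Néron-type period pair `L_A` of `A` and `α ≠ 0` with
  `T_ℓ g = a_ℓ(A) g` (`ℓ ∤ N` prime) and the periods of `α g` in `Λ_{L_A}`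
  — Pasten §4.11 p. 16 (`q_{[χ]} : J₀^D(M) → A_{[χ]}`, `dim A_{[χ]} = #[χ]`, Hecke-equivariant);
  Zhang 2001 §3.4; the `D = 1` twin is the tree's `eichlerShimuraConstruction` (Knapp Thm. 11.74).

What is proved here (sorry-free, standard axioms):

* `isIsogenous_of_lFunction_prime_eq_of_not_dvd` — **Faltings, cofinite `L`-coefficient form**:
  elliptic `W, W'/ℚ` with `a_ℓ(W) = a_ℓ(W')` for all primes `ℓ ∤ N₀` (`N₀ ≠ 0`) are `ℚ`-isogenous
  (from the tree's THEOREM `isIsogenous_iff_frobeniusTrace_eq_holds`, via global minimal models and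
  `a_ℓ = frobeniusTrace` at good `ℓ`, as in the tree's `isIsogenous_of_LFunction_eq`);
* `ShimuraParametrizationData.nonempty_of_isIsogenous` — **the conclusion of the fact is an
  invariant of the `ℚ`-isogeny class**: a datum of `W` on `X` yields a datum of every elliptic `W'`
  `ℚ`-isogenous to `W` (the composite datum `exists_deg_eq_natCard_ker_mul` of
  `ShimuraCurveMinimalDegreeIsogenyBoundProofs` fed with `neronLattice_commensurable_of_isIsogenous_holds`
  and `IsIsogenous.LFunction_eq`) — Pasten's "composing with an isogeny `A_{D,M} → E`";
* `nonempty_shimuraParametrizationData_iff_forall_isElliptic` — hence the hypothesis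
  `[W.IsGloballyMinimal]` of the fact is cosmetic: the fact is equivalent to the same statement for
  every elliptic `W/ℚ` of conductor `N` (every model is `ℚ`-isomorphic, so isogenous, to a global
  minimal model, `hasGlobalMinimalModel_rat_holds`, with the same conductor);
* `heckeEigenvalue_unique` — a non-zero common eigenfunction pins its eigenvalue;
* `exists_eigenform_neronPeriods_of_transfer_of_shimuraConstruction`,
  `eigenform_neronPeriods_of_transfer_of_shimuraConstruction` — the `D > 1` eigenform with periods
  in `Λ_W` (hypothesis `hJL` of `nonempty_shimuraParametrizationData_of_exists_isNewformOf`) from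
  `exists_isNewformOf`, the transfer (T) and Shimura's construction (S₁): `a_ℓ(A) = a_ℓ(W)` for
  `ℓ ∤ N` (eigenvalue uniqueness), so `A ~ W` (Faltings), `a Λ_A ⊆ Λ_W` for some `a ∈ ℤ ∖ {0}`
  (commensurability), and `h = (a α) g`;
* `nonempty_shimuraParametrizationData_of_exists_isNewformOf_of_transfer_of_shimuraConstruction`
  — **the fact from `exists_isNewformOf` ∧ (T) ∧ (S₁)**; and `construction_of_shimuraConstruction`
  — (S₁) implies the earlier bundled hypothesis (S), so this reduction refines the earlier one.

## References

* H. Pasten, *Shimura curves and the abc conjecture*, J. Number Theory 254 (2024) 214–335 =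
  arXiv:1705.09251 (held, read): §2 p. 12, §4.9–4.11 p. 16, proof of Prop. 5.1 p. 17.
  [PastenShimura2024]
* S.-W. Zhang, *Heights of Heegner points on Shimura curves*, Ann. of Math. 153 (2001), §3.4.
  [ZhangHeegnerShimura2001]
* H. Darmon, *Rational points on modular elliptic curves*, CBMS 101 (2004), Thm. 4.11–4.13, §4.6.
  [Darmon2004]
* G. Faltings, Invent. Math. 73 (1983), §5 Kor. 2. [Faltings1983Endlichkeit]
* J. H. Silverman, *The Arithmetic of Elliptic Curves*, GTM 106 (2009), Thm. VI.4.1, VI.5.3.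
  [SilvermanAEC2009]
-/

noncomputable section

open scoped MatrixGroups ModularForm
open _root_.MeasureTheory UpperHalfPlane CongruenceSubgroup

namespace Literature.NumberTheory.Automorphic

open Literature.NumberTheory.EllipticCurves.ModularForms _root_.WeierstrassCurve

/-! ### 1. Faltings' isogeny theorem, cofinite `L`-coefficient form -/

/-- **Elliptic curves over `ℚ` with the same `a_ℓ` for all primes `ℓ ∤ N₀` are `ℚ`-isogenous**
(`N₀ ≠ 0`; Faltings 1983, §5 Kor. 2 — the tree's theorem
`isIsogenous_iff_frobeniusTrace_eq_holds` for global minimal models). For arbitrary models: pass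
to global minimal models `C • W`, `C' • W'` (`hasGlobalMinimalModel_rat_holds`; `LFunction_smul`);
at a prime `ℓ ∤ N₀ Δ_min Δ'_min` both have good reduction and `a_ℓ = frobeniusTrace`
(`LFunction_apply_prime_eq_frobeniusTrace`), so the exceptional set of the named fact is finite;
then `W ~ C • W ~ C' • W' ~ W'`. [cite: Faltings1983Endlichkeit, §5 Korollar 2 (i) ⟺ (iii)] -/
theorem isIsogenous_of_lFunction_prime_eq_of_not_dvd {W W' : WeierstrassCurve ℚ} [W.IsElliptic]
    [W'.IsElliptic] {N₀ : ℕ} (hN₀ : N₀ ≠ 0)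
    (h : ∀ ℓ : ℕ, ℓ.Prime → ¬ ℓ ∣ N₀ → W.LFunction ℓ = W'.LFunction ℓ) : IsIsogenous W W' := by
  obtain ⟨C, hC⟩ := hasGlobalMinimalModel_rat_holds W
  obtain ⟨C', hC'⟩ := hasGlobalMinimalModel_rat_holds W'
  haveI := hC
  haveI := hC'
  have hMM' : IsIsogenous (C • W) (C' • W') := by
    refine (isIsogenous_iff_frobeniusTrace_eq_holds (C • W) (C' • W')).mpr ?_
    have hD : minimalDiscriminantInt (C • W) * minimalDiscriminantInt (C' • W') ≠ 0 :=
      mul_ne_zero (minimalDiscriminantInt_ne_zero _) (minimalDiscriminantInt_ne_zero _)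
    refine (Set.finite_Iic (max N₀
      (minimalDiscriminantInt (C • W) * minimalDiscriminantInt (C' • W')).natAbs)).subset ?_
    rintro p ⟨hp, hne⟩
    simp only [Set.mem_Iic, le_max_iff]
    by_contra hlt
    push Not at hlt
    haveI : Fact p.Prime := ⟨hp⟩
    have hpN₀ : ¬ p ∣ N₀ := fun hd =>
      absurd (Nat.le_of_dvd (Nat.pos_of_ne_zero hN₀) hd) (not_le.mpr hlt.1)
    have hndvd :
        ¬ (p : ℤ) ∣ minimalDiscriminantInt (C • W) * minimalDiscriminantInt (C' • W') := fun hd =>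
      absurd (Nat.le_of_dvd (Int.natAbs_pos.mpr hD) (Int.ofNat_dvd_left.mp hd)) (not_le.mpr hlt.2)
    have h₁ : (C • W).HasGoodReductionAtPrime p :=
      hasGoodReductionAtPrime_of_not_dvd _ p fun hd => hndvd (hd.mul_right _)
    have h₂ : (C' • W').HasGoodReductionAtPrime p :=
      hasGoodReductionAtPrime_of_not_dvd _ p fun hd => hndvd (hd.mul_left _)
    apply hne
    rw [← LFunction_apply_prime_eq_frobeniusTrace _ p h₁,
      ← LFunction_apply_prime_eq_frobeniusTrace _ p h₂, LFunction_smul, LFunction_smul]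
    exact h p hp hpN₀
  have h1 : IsIsogenous W (C • W) := (isIsogenous_self W).smul_right C
  have h3 : IsIsogenous (C' • W') W' := ((isIsogenous_self W').smul_right C').symm_of_charZero
  exact h1.trans' (hMM'.trans' h3)

/-! ### 2. Data along `ℚ`-isogenies -/

namespace ShimuraParametrizationData

variable {D M : ℕ} {X : ShimuraCurveData D M}

/-- **A Shimura-curve parametrisation of `W` gives one of every `ℚ`-isogenous `W'`.** With `Λ`
the datum lattice of `W` and `Λ'` any Néron-type lattice of `W'` (`exists_isNeronLatticeOf_holds`),
`a Λ ⊆ Λ'` for a non-zero integer `a` (`neronLattice_commensurable_of_isIsogenous_holds`: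
an isogeny is `z ↦ αz` on `ℂ/Λ → ℂ/Λ'` with `α ∈ ℚ^×`), and `L(W, s) = L(W', s)`
(`IsIsogenous.LFunction_eq`, so the Hecke line is unchanged); the composite datum
`exists_deg_eq_natCard_ker_mul` (form `a · form`, uniformisation of `Λ'`, fibre count of
`Γ∖ℍ → W(ℂ) → W'(ℂ)`) is a datum of `W'`. This is Pasten's "composing `q ∘ j_{p₀}` with an isogeny
`A_{D,M} → E`" (proof of Prop. 5.1 p. 17; §16 p. 49) in the tree's analytic currency.
[cite: PastenShimura2024, proof of Prop. 5.1 p. 17 and §16 p. 49] -/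
theorem nonempty_of_isIsogenous {W W' : WeierstrassCurve ℚ} [W.IsElliptic] [W'.IsElliptic]
    (P : ShimuraParametrizationData X W) (hWW' : IsIsogenous W W') :
    Nonempty (ShimuraParametrizationData X W') := by
  haveI : (W'.baseChange ℂ).IsElliptic := by
    rw [WeierstrassCurve.baseChange]; infer_instance
  obtain ⟨L', hL'⟩ := exists_isNeronLatticeOf_holds (W'.baseChange ℂ)
  obtain ⟨a, ha0, ha⟩ :=
    neronLattice_commensurable_of_isIsogenous_holds hWW' P.isNeronLattice hL'
  have ha0' : (a : ℂ) ≠ 0 := by exact_mod_cast ha0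
  obtain ⟨P', -⟩ := P.exists_deg_eq_natCard_ker_mul hWW'.LFunction_eq hL' ha0' ha
  exact ⟨P'⟩

/-- Isogeny invariance of `Nonempty (ShimuraParametrizationData X ·)` on an isogeny class.
[cite: PastenShimura2024, proof of Prop. 5.1 p. 17] -/
theorem nonempty_iff_of_isIsogenous {W W' : WeierstrassCurve ℚ} [W.IsElliptic] [W'.IsElliptic]
    (hWW' : IsIsogenous W W') :
    Nonempty (ShimuraParametrizationData X W) ↔ Nonempty (ShimuraParametrizationData X W') :=
  ⟨fun ⟨P⟩ => P.nonempty_of_isIsogenous hWW', fun ⟨P'⟩ =>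
    P'.nonempty_of_isIsogenous hWW'.symm_of_charZero⟩

end ShimuraParametrizationData

/-- **The global-minimality hypothesis of the fact is cosmetic.** `nonempty_shimuraParametrizationData`
(stated for globally minimal `W`) is equivalent to the same statement for every elliptic `W/ℚ` of
conductor `N`: a model `W` is `ℚ`-isomorphic — in particular `ℚ`-isogenous — to a global minimal
model `C • W` (`hasGlobalMinimalModel_rat_holds`) of the same conductor (`conductorNorm_smul`), and
data transport along isogenies (`ShimuraParametrizationData.nonempty_of_isIsogenous`). [folklore] -/
theorem nonempty_shimuraParametrizationData_iff_forall_isElliptic :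
    nonempty_shimuraParametrizationData ↔
      ∀ {N D M : ℕ}, IsAdmissibleFactorization N D M →
        ∀ (X : ShimuraCurveData D M) (W : WeierstrassCurve ℚ) [W.IsElliptic],
          W.conductorNorm ℤ = N → Nonempty (ShimuraParametrizationData X W) := by
  refine ⟨fun hP N D M hNDM X W _ hN => ?_, fun h N D M hNDM X W _ _ hN => h hNDM X W hN⟩
  obtain ⟨C, hC⟩ := hasGlobalMinimalModel_rat_holds W
  haveI := hC
  have hN' : (C • W).conductorNorm ℤ = N := by rw [conductorNorm_smul, hN]
  obtain ⟨P⟩ := hP hNDM X (C • W) hN'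
  exact P.nonempty_of_isIsogenous ((isIsogenous_self W).smul_right C).symm_of_charZero

/-! ### 3. Eigenvalues of a non-zero eigenfunction -/

/-- A non-zero function which is a `T`-eigenfunction for two scalars has equal scalars.
[folklore] -/
theorem heckeEigenvalue_unique {D M : ℕ} (X : ShimuraCurveData D M) {n : ℕ} {g : ℍ → ℂ}
    (hg : g ≠ 0) {a b : ℂ} (ha : X.heckeFun n g = fun τ => a * g τ)
    (hb : X.heckeFun n g = fun τ => b * g τ) : a = b := by
  obtain ⟨τ, hτ⟩ : ∃ τ, g τ ≠ 0 := by
    by_contra hcon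
    push Not at hcon
    exact hg (funext hcon)
  have := congrFun (ha.symm.trans hb) τ
  exact mul_right_cancel₀ hτ this

/-! ### 4. The reduction: Modularity + transfer (T) + Shimura's construction (S₁) -/

section Reduction

/-- **The `D > 1` eigenform with periods in `Λ_W`, pointwise, from the transfer of the newform and
Shimura's construction `A_g`.** Let `W/ℚ` be elliptic with newform `f` at level `N`
(`IsNewformOf W f`, `N ≠ 0`), `X` a datum and `L` a Néron-type period pair of `W`. Suppose
(T) `f` transfers to a non-zero `g ∈ S₂(X.Gamma)` with `T_ℓ g = a_ℓ(f) g` (`ℓ ∤ N` prime), and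
(S₁) every non-zero `g ∈ S₂(X.Gamma)` in the Hecke line of `W` away from `N` is in the Hecke line of
some elliptic `A/ℚ` — `T_ℓ g = a_ℓ(A) g`, `ℓ ∤ N` — with a multiple `α g`, `α ≠ 0`, having its
periods in a Néron lattice `Λ_A` of `A`. Then some non-zero `h ∈ S₂(X.Gamma)` has periods in `Λ_L`
and `T_ℓ h = a_ℓ(W) h` (`ℓ ∤ N`): `a_ℓ(A) = a_ℓ(f) = a_ℓ(W)` for `ℓ ∤ N` (`g ≠ 0`), so `A ~ W` over
`ℚ` (Faltings, `isIsogenous_of_lFunction_prime_eq_of_not_dvd`), `a Λ_A ⊆ Λ_L` with `a ∈ ℤ ∖ {0}`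
(`neronLattice_commensurable_of_isIsogenous_holds`), and `h = (a α) g`.
[cite: PastenShimura2024, §2 p. 12 and §4.10–4.11 p. 16] [cite: Faltings1983Endlichkeit, §5 Korollar 2] -/
theorem exists_eigenform_neronPeriods_of_transfer_of_shimuraConstruction {N D M : ℕ} [NeZero N]
    (X : ShimuraCurveData D M) (W : WeierstrassCurve ℚ) [W.IsElliptic] {f : CuspForm (Gamma0 N) 2}
    (hf : IsNewformOf W f) {L : PeriodPair} (hL : IsNeronLatticeOf (W.baseChange ℂ) L)
    (hT : ∃ g : CuspForm X.Gamma 2, (⇑g : ℍ → ℂ) ≠ 0 ∧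
      ∀ ℓ : ℕ, ℓ.Prime → ¬ ℓ ∣ N → X.heckeFun ℓ g = fun τ => cuspCoeff f ℓ * g τ)
    (hS : ∀ g : CuspForm X.Gamma 2, (⇑g : ℍ → ℂ) ≠ 0 →
      (∀ ℓ : ℕ, ℓ.Prime → ¬ ℓ ∣ N → X.heckeFun ℓ g = fun τ => ((W.LFunction ℓ : ℤ) : ℂ) * g τ) →
      ∃ (A : WeierstrassCurve ℚ) (_ : A.IsElliptic) (L_A : PeriodPair) (α : ℂ),
        IsNeronLatticeOf (A.baseChange ℂ) L_A ∧ α ≠ 0 ∧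
        (∀ ℓ : ℕ, ℓ.Prime → ¬ ℓ ∣ N → X.heckeFun ℓ g = fun τ => ((A.LFunction ℓ : ℤ) : ℂ) * g τ) ∧
        HasPeriodsIn X.Gamma (fun τ => α * g τ) (L_A.lattice : Set ℂ)) :
    ∃ h : CuspForm X.Gamma 2, (⇑h : ℍ → ℂ) ≠ 0 ∧
      HasPeriodsIn X.Gamma h (L.lattice : Set ℂ) ∧
      ∀ ℓ : ℕ, ℓ.Prime → ¬ ℓ ∣ N →
        X.heckeFun ℓ h = fun τ => ((W.LFunction ℓ : ℤ) : ℂ) * h τ := by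
  obtain ⟨g, hg0, hg⟩ := hT
  have hg' : ∀ ℓ : ℕ, ℓ.Prime → ¬ ℓ ∣ N →
      X.heckeFun ℓ g = fun τ => ((W.LFunction ℓ : ℤ) : ℂ) * g τ := fun ℓ hℓ hℓN => by
    rw [hg ℓ hℓ hℓN, hf.2 ℓ]
  obtain ⟨A, _, L_A, α, hLA, hα0, hgA, hαper⟩ := hS g hg0 hg'
  -- `a_ℓ(A) = a_ℓ(W)` for primes `ℓ ∤ N`
  have hAW : ∀ ℓ : ℕ, ℓ.Prime → ¬ ℓ ∣ N → A.LFunction ℓ = W.LFunction ℓ := fun ℓ hℓ hℓN => by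
    have := heckeEigenvalue_unique X hg0 (hgA ℓ hℓ hℓN) (hg' ℓ hℓ hℓN)
    exact_mod_cast this
  -- Faltings: `A ~ W`; commensurability: `a Λ_A ⊆ Λ_L`
  have hiso : IsIsogenous A W := isIsogenous_of_lFunction_prime_eq_of_not_dvd (NeZero.ne N) hAW
  obtain ⟨a, ha0, ha⟩ := neronLattice_commensurable_of_isIsogenous_holds hiso hLA hL
  have haα : (a : ℂ) * α ≠ 0 := mul_ne_zero (by exact_mod_cast ha0) hα0
  have hper : HasPeriodsIn X.Gamma (fun τ => ((a : ℂ) * α) * g τ) (L.lattice : Set ℂ) := by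
    intro γ hγ z
    have h1 := hαper γ hγ z
    rw [segmentIntegral_const_mul] at h1 ⊢
    rw [mul_assoc]
    exact ha _ h1
  exact ⟨((a : ℂ) * α) • g, coe_smul_ne_zero X haα hg0, hasPeriodsIn_coe_smul X _ g hper,
    fun ℓ hℓ hℓN => heckeFun_coe_smul_eq X hℓ.pos _ _ g (hg' ℓ hℓ hℓN)⟩

/-- **The hypothesis `hJL` of `nonempty_shimuraParametrizationData_of_exists_isNewformOf` from the
Modularity theorem, the Jacquet–Langlands transfer (T) and Shimura's construction (S₁)** — the
three published inputs of Pasten §2 p. 12 at `D > 1`, with Faltings' isogeny theorem and the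
commensurability of Néron lattices supplied by the tree. Hypotheses, each in the shape a named
fact would have: `hmod = exists_isNewformOf` (Diamond–Shurman Thm. 8.8.3); `hT` (Darmon Thm. 4.12;
Jacquet–Langlands Thm. 16.1; Pasten §4.10): a newform of level `N = D M` transfers to a non-zero
`T_ℓ`-eigenform on `X` with the same eigenvalues away from `N`; `hS` = (S₁) (Pasten §4.11;
Zhang 2001 §3.4; the `D = 1` twin is `eichlerShimuraConstruction`): a non-zero form on `X` in the
Hecke line of an elliptic curve of conductor `N` is in the Hecke line of an elliptic `A/ℚ` and has
a multiple with periods in a Néron lattice of `A`.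
[cite: PastenShimura2024, §2 p. 12 and §4.10–4.11 p. 16] [cite: Darmon2004, Thm. 4.12 and Thm. 4.11 with §4.6]
[cite: DiamondShurman2005, Thm. 8.8.3] -/
theorem eigenform_neronPeriods_of_transfer_of_shimuraConstruction (hmod : exists_isNewformOf)
    (hT : ∀ {N D M : ℕ} [NeZero N], IsAdmissibleFactorization N D M → 1 < D →
      ∀ (X : ShimuraCurveData D M) (f : CuspForm (Gamma0 N) 2), IsNewform0 f →
        ∃ g : CuspForm X.Gamma 2, (⇑g : ℍ → ℂ) ≠ 0 ∧
          ∀ ℓ : ℕ, ℓ.Prime → ¬ ℓ ∣ N → X.heckeFun ℓ g = fun τ => cuspCoeff f ℓ * g τ)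
    (hS : ∀ {N D M : ℕ}, IsAdmissibleFactorization N D M → 1 < D →
      ∀ (X : ShimuraCurveData D M) (W : WeierstrassCurve ℚ) [W.IsElliptic],
        W.conductorNorm ℤ = N → ∀ (g : CuspForm X.Gamma 2), (⇑g : ℍ → ℂ) ≠ 0 →
        (∀ ℓ : ℕ, ℓ.Prime → ¬ ℓ ∣ N →
          X.heckeFun ℓ g = fun τ => ((W.LFunction ℓ : ℤ) : ℂ) * g τ) →
        ∃ (A : WeierstrassCurve ℚ) (_ : A.IsElliptic) (L_A : PeriodPair) (α : ℂ),
          IsNeronLatticeOf (A.baseChange ℂ) L_A ∧ α ≠ 0 ∧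
          (∀ ℓ : ℕ, ℓ.Prime → ¬ ℓ ∣ N →
            X.heckeFun ℓ g = fun τ => ((A.LFunction ℓ : ℤ) : ℂ) * g τ) ∧
          HasPeriodsIn X.Gamma (fun τ => α * g τ) (L_A.lattice : Set ℂ))
    {N D M : ℕ} (hNDM : IsAdmissibleFactorization N D M) (hD : 1 < D) (X : ShimuraCurveData D M)
    (W : WeierstrassCurve ℚ) [W.IsElliptic] (hN : W.conductorNorm ℤ = N)
    {L : PeriodPair} (hL : IsNeronLatticeOf (W.baseChange ℂ) L) :
    ∃ h : CuspForm X.Gamma 2, (⇑h : ℍ → ℂ) ≠ 0 ∧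
      HasPeriodsIn X.Gamma h (L.lattice : Set ℂ) ∧
      ∀ ℓ : ℕ, ℓ.Prime → ¬ ℓ ∣ D * M →
        X.heckeFun ℓ h = fun τ => ((W.LFunction ℓ : ℤ) : ℂ) * h τ := by
  subst hN
  haveI : NeZero (W.conductorNorm ℤ) := ⟨hNDM.pos.ne'⟩
  obtain ⟨f, hf⟩ := hmod W
  obtain ⟨h, hh0, hper, hhecke⟩ :=
    exists_eigenform_neronPeriods_of_transfer_of_shimuraConstruction X W hf hL
      (hT hNDM hD X f hf.1) (fun g hg0 hg => hS hNDM hD X W rfl g hg0 hg)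
  refine ⟨h, hh0, hper, fun ℓ hℓ hℓDM => hhecke ℓ hℓ ?_⟩
  rwa [← hNDM.mul_eq]

/-- **`nonempty_shimuraParametrizationData` from the Modularity theorem, the Jacquet–Langlands
transfer of newforms to `X₀^D(M)` (T) and Shimura's construction `A_{[χ]}` on `J₀^D(M)` (S₁)**
(`D > 1`; at `D = 1` everything beyond modularity is a theorem of the tree,
`automorphicHalf_one_of_exists_isNewformOf`). Compared with
`nonempty_shimuraParametrizationData_of_exists_isNewformOf_of_transfer_of_construction`, Faltings'
isogeny theorem and the commensurability of Néron lattices are no longer hypotheses but the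
tree's theorems; the open content of the fact is named to the letter as `exists_isNewformOf`,
(T) and (S₁). [cite: PastenShimura2024, §2 p. 12, §4.10–4.11 p. 16 and Prop. 5.1 p. 17]
[cite: Darmon2004, Thm. 4.11, Thm. 4.12, Thm. 4.13 and §4.6 pp. 51–52] [cite: DiamondShurman2005, Thm. 8.8.3] -/
theorem nonempty_shimuraParametrizationData_of_exists_isNewformOf_of_transfer_of_shimuraConstruction
    (hmod : exists_isNewformOf)
    (hT : ∀ {N D M : ℕ} [NeZero N], IsAdmissibleFactorization N D M → 1 < D →
      ∀ (X : ShimuraCurveData D M) (f : CuspForm (Gamma0 N) 2), IsNewform0 f →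
        ∃ g : CuspForm X.Gamma 2, (⇑g : ℍ → ℂ) ≠ 0 ∧
          ∀ ℓ : ℕ, ℓ.Prime → ¬ ℓ ∣ N → X.heckeFun ℓ g = fun τ => cuspCoeff f ℓ * g τ)
    (hS : ∀ {N D M : ℕ}, IsAdmissibleFactorization N D M → 1 < D →
      ∀ (X : ShimuraCurveData D M) (W : WeierstrassCurve ℚ) [W.IsElliptic],
        W.conductorNorm ℤ = N → ∀ (g : CuspForm X.Gamma 2), (⇑g : ℍ → ℂ) ≠ 0 →
        (∀ ℓ : ℕ, ℓ.Prime → ¬ ℓ ∣ N →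
          X.heckeFun ℓ g = fun τ => ((W.LFunction ℓ : ℤ) : ℂ) * g τ) →
        ∃ (A : WeierstrassCurve ℚ) (_ : A.IsElliptic) (L_A : PeriodPair) (α : ℂ),
          IsNeronLatticeOf (A.baseChange ℂ) L_A ∧ α ≠ 0 ∧
          (∀ ℓ : ℕ, ℓ.Prime → ¬ ℓ ∣ N →
            X.heckeFun ℓ g = fun τ => ((A.LFunction ℓ : ℤ) : ℂ) * g τ) ∧
          HasPeriodsIn X.Gamma (fun τ => α * g τ) (L_A.lattice : Set ℂ)) :
    nonempty_shimuraParametrizationData :=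
  nonempty_shimuraParametrizationData_of_exists_isNewformOf hmod
    (fun hNDM hD X W _ _ hN _ hL =>
      eigenform_neronPeriods_of_transfer_of_shimuraConstruction hmod hT hS hNDM hD X W hN hL)

/-- **(S₁) refines (S).** Shimura's construction (S₁) implies the bundled hypothesis (S) of
`nonempty_shimuraParametrizationData_of_exists_isNewformOf_of_transfer_of_construction`
(a non-zero form in the Hecke line of `W`, conductor `N`, has a multiple with periods in `Λ_W`):
Faltings and commensurability, as in `exists_eigenform_neronPeriods_of_transfer_of_shimuraConstruction`.
[cite: PastenShimura2024, §2 p. 12 and §4.11 p. 16] [cite: Faltings1983Endlichkeit, §5 Korollar 2] -/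
theorem construction_of_shimuraConstruction
    (hS : ∀ {N D M : ℕ}, IsAdmissibleFactorization N D M → 1 < D →
      ∀ (X : ShimuraCurveData D M) (W : WeierstrassCurve ℚ) [W.IsElliptic],
        W.conductorNorm ℤ = N → ∀ (g : CuspForm X.Gamma 2), (⇑g : ℍ → ℂ) ≠ 0 →
        (∀ ℓ : ℕ, ℓ.Prime → ¬ ℓ ∣ N →
          X.heckeFun ℓ g = fun τ => ((W.LFunction ℓ : ℤ) : ℂ) * g τ) →
        ∃ (A : WeierstrassCurve ℚ) (_ : A.IsElliptic) (L_A : PeriodPair) (α : ℂ),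
          IsNeronLatticeOf (A.baseChange ℂ) L_A ∧ α ≠ 0 ∧
          (∀ ℓ : ℕ, ℓ.Prime → ¬ ℓ ∣ N →
            X.heckeFun ℓ g = fun τ => ((A.LFunction ℓ : ℤ) : ℂ) * g τ) ∧
          HasPeriodsIn X.Gamma (fun τ => α * g τ) (L_A.lattice : Set ℂ))
    {N D M : ℕ} (hNDM : IsAdmissibleFactorization N D M) (hD : 1 < D)
    (X : ShimuraCurveData D M) (W : WeierstrassCurve ℚ) [W.IsElliptic]
    (hN : W.conductorNorm ℤ = N) (g : CuspForm X.Gamma 2) (hg0 : (⇑g : ℍ → ℂ) ≠ 0)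
    (hg : ∀ ℓ : ℕ, ℓ.Prime → ¬ ℓ ∣ N →
      X.heckeFun ℓ g = fun τ => ((W.LFunction ℓ : ℤ) : ℂ) * g τ)
    {L : PeriodPair} (hL : IsNeronLatticeOf (W.baseChange ℂ) L) :
    ∃ α : ℂ, α ≠ 0 ∧ HasPeriodsIn X.Gamma (fun τ => α * g τ) (L.lattice : Set ℂ) := by
  have hN0 : N ≠ 0 := hNDM.pos.ne'
  obtain ⟨A, _, L_A, α, hLA, hα0, hgA, hαper⟩ := hS hNDM hD X W hN g hg0 hg
  have hAW : ∀ ℓ : ℕ, ℓ.Prime → ¬ ℓ ∣ N → A.LFunction ℓ = W.LFunction ℓ := fun ℓ hℓ hℓN => by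
    have := heckeEigenvalue_unique X hg0 (hgA ℓ hℓ hℓN) (hg ℓ hℓ hℓN)
    exact_mod_cast this
  have hiso : IsIsogenous A W := isIsogenous_of_lFunction_prime_eq_of_not_dvd hN0 hAW
  obtain ⟨a, ha0, ha⟩ := neronLattice_commensurable_of_isIsogenous_holds hiso hLA hL
  refine ⟨(a : ℂ) * α, mul_ne_zero (by exact_mod_cast ha0) hα0, fun γ hγ z => ?_⟩
  have h1 := hαper γ hγ z
  rw [segmentIntegral_const_mul] at h1 ⊢
  rw [mul_assoc]
  exact ha _ h1

end Reduction

end Literature.NumberTheory.Automorphic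

end
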